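import Summits.Ventures.Crystal3D.Theorems.StickyWulffConstantCoaxialWallLawEndRowOnSiteDefsA
import Summits.Ventures.Crystal3D.Theorems.StickyWulffConstantCoaxialWallLawEndRowPattern
import Summits.Ventures.Crystal3D.Theorems.StickyWulffConstantCoaxialWallLawEndRowTail
import Summits.Ventures.Crystal3D.Theorems.StickyWulffConstantCoaxialWallLawTwoLatticeAdm
import HarnessLib

/-!
# Locality and rigid-motion transport of the census row's predicates (plumbing for the on-site bridge)

HONEST FRAMING. Venture `Summits/Ventures/Crystal3D` (cell `crystal3d-full`), helper `--supports` the crux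
`CoaxialWallLaw` (stmt-Ventures-19481, `route-Ventures-StickyWulffConstant`), REGISTERED line `WallLedgerF` (planner
cf-p1).  Rung credit; F-C1 not moved; pure bookkeeping on `…EndRowDefs` / `…EndRowDefsA` / `…EndRowOnSiteDefsA`.
cf-p1 ORDER 2026-08-28T21:28:15Z item (2) (the bridge «on-site fact ⇒ typed row at on-site windows») and PREREG-F-CERT
Q3 («degrees/readings need only the closed window»):

* LOCALITY — two configurations that agree on a ball define the same predicates there: `filter_congr_of_agree`,
  `degree_congr_of_agree`, `hasTwoPayers_congr_of_agree` (ball `B̄(b,2)`), `pooledDef_congr_of_agree` (ball `B̄(b,2)`),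
  `isFull_congr_of_agree`, `isTwinReading_congr_of_agree`, `isNarrow_congr_of_agree`, `isMoving_congr_of_agree`,
  **`isEndMove_congr_of_agree`** (balls `B̄(q,1) ∪ B̄(b,1)`, unit direction);
* TRANSPORT under the rigid motion `T x = S x + c` — `degree_transport`, `hasTwoPayers_transport`,
  `pooledDef_transport`, `PlateSystem.fw_trans` / `PlateSystem.adm_transport` (the frames of the transported plate
  system are the transported frames), `isEndPairA_transport`;
* `onSite_window_agree` — under `OnSiteAt 𝒰 X z` with witness `(P, S)`, the transported configuration
  `X.image (S⁻¹(· − z))` agrees with the pattern `P` on the closed ball `B̄(0, 3)`.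
WHAT THIS IS NOT: not the bridge's domination step (next file); F-C1 not moved.
-/

noncomputable section

namespace Summit.Ventures.Crystal3D.Theorems

open Summit.Ventures.Crystal3D Finset
open scoped InnerProductSpace

/-! ### Locality -/

section Agree

variable {X Y : Finset (EuclideanSpace ℝ (Fin 3))} {c : EuclideanSpace ℝ (Fin 3)} {ρ : ℝ}

/-- Filters by a predicate supported in the ball of agreement coincide. -/
theorem filter_congr_of_agree (h : ∀ x, dist c x ≤ ρ → (x ∈ X ↔ x ∈ Y)) (P : EuclideanSpace ℝ (Fin 3) → Prop)
    [DecidablePred P] (hP : ∀ x, P x → dist c x ≤ ρ) : X.filter P = Y.filter P := by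
  ext x
  simp only [mem_filter]
  constructor
  · rintro ⟨hx, hPx⟩; exact ⟨(h x (hP x hPx)).1 hx, hPx⟩
  · rintro ⟨hx, hPx⟩; exact ⟨(h x (hP x hPx)).2 hx, hPx⟩

open scoped Classical in
/-- Degrees agree at centres within `ρ − 1` of `c`. -/
theorem degree_congr_of_agree (h : ∀ x, dist c x ≤ ρ → (x ∈ X ↔ x ∈ Y)) {y : EuclideanSpace ℝ (Fin 3)}
    (hy : dist c y + 1 ≤ ρ) : (X.filter fun q => dist y q = 1).card = (Y.filter fun q => dist y q = 1).card := by
  rw [filter_congr_of_agree h (fun q => dist y q = 1) fun q hq => by linarith [dist_triangle c y q]]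

open scoped Classical in
/-- `HasTwoPayers` agrees at balls within `ρ − 2` of `c`. -/
theorem hasTwoPayers_congr_of_agree (h : ∀ x, dist c x ≤ ρ → (x ∈ X ↔ x ∈ Y)) {b : EuclideanSpace ℝ (Fin 3)}
    (hb : dist c b + 2 ≤ ρ) : HasTwoPayers X b ↔ HasTwoPayers Y b := by
  unfold HasTwoPayers
  have hdeg : ∀ y, dist b y ≤ 1 → (X.filter fun q => dist y q = 1).card = (Y.filter fun q => dist y q = 1).card :=
    fun y hy => degree_congr_of_agree h (by linarith [dist_triangle c b y])
  rw [hdeg b (by simp)]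
  refine or_congr Iff.rfl ⟨?_, ?_⟩
  · rintro ⟨z₁, hz₁, z₂, hz₂, hne, hd₁, hd₂, hc₁, hc₂⟩
    refine ⟨z₁, (h z₁ (by linarith [dist_triangle c b z₁])).1 hz₁, z₂, (h z₂ (by linarith [dist_triangle c b z₂])).1 hz₂,
      hne, hd₁, hd₂, ?_, ?_⟩
    · rwa [← hdeg z₁ hd₁.le]
    · rwa [← hdeg z₂ hd₂.le]
  · rintro ⟨z₁, hz₁, z₂, hz₂, hne, hd₁, hd₂, hc₁, hc₂⟩
    refine ⟨z₁, (h z₁ (by linarith [dist_triangle c b z₁])).2 hz₁, z₂, (h z₂ (by linarith [dist_triangle c b z₂])).2 hz₂,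
      hne, hd₁, hd₂, ?_, ?_⟩
    · rwa [hdeg z₁ hd₁.le]
    · rwa [hdeg z₂ hd₂.le]

open scoped Classical in
/-- `pooledDef` agrees at balls within `ρ − 2` of `c`. -/
theorem pooledDef_congr_of_agree (h : ∀ x, dist c x ≤ ρ → (x ∈ X ↔ x ∈ Y)) {b : EuclideanSpace ℝ (Fin 3)}
    (hb : dist c b + 2 ≤ ρ) : pooledDef X b = pooledDef Y b := by
  unfold pooledDef
  have hdeg : ∀ y, dist b y ≤ 1 → (X.filter fun q => dist y q = 1).card = (Y.filter fun q => dist y q = 1).card :=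
    fun y hy => degree_congr_of_agree h (by linarith [dist_triangle c b y])
  have hset : X.filter (fun z => dist b z ≤ 1 ∧ (X.filter fun q => dist z q = 1).card ≤ 11) =
      Y.filter (fun z => dist b z ≤ 1 ∧ (Y.filter fun q => dist z q = 1).card ≤ 11) := by
    ext z
    simp only [mem_filter]
    constructor
    · rintro ⟨hz, hd, hc⟩
      exact ⟨(h z (by linarith [dist_triangle c b z])).1 hz, hd, by rwa [← hdeg z hd]⟩
    · rintro ⟨hz, hd, hc⟩
      exact ⟨(h z (by linarith [dist_triangle c b z])).2 hz, hd, by rwa [hdeg z hd]⟩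
  rw [hset]
  refine sum_congr rfl fun z hz => ?_
  rw [hdeg z (mem_filter.1 hz).2.1]

/-- `IsFull` agrees. -/
theorem isFull_congr_of_agree (h : ∀ x, dist c x ≤ ρ → (x ∈ X ↔ x ∈ Y))
    (G : EuclideanSpace ℝ (Fin 3) ≃ₗᵢ[ℝ] EuclideanSpace ℝ (Fin 3)) {b : EuclideanSpace ℝ (Fin 3)} (hb : dist c b + 1 ≤ ρ) :
    IsFull X G b ↔ IsFull Y G b := by
  unfold IsFull
  refine forall₂_congr fun w hw => h _ ?_
  have : dist b (b + G w) = 1 := by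
    rw [dist_eq_norm, sub_add_cancel_left, norm_neg, LinearIsometryEquiv.norm_map, norm_eq_one_of_mem_fccSlots hw]
  linarith [dist_triangle c b (b + G w)]

/-- `IsMenuNormal`'s mirror step keeps unit length: `‖G w − 2⟪G w, m⟫ m‖ = 1`. -/
theorem norm_reflectStep_slot (G : EuclideanSpace ℝ (Fin 3) ≃ₗᵢ[ℝ] EuclideanSpace ℝ (Fin 3)) {m w : EuclideanSpace ℝ (Fin 3)}
    (hm : ‖m‖ = 1) (hw : w ∈ fccSlots) : ‖G w - (2 * ⟪G w, m⟫_ℝ) • m‖ = 1 := by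
  have h1 : ‖G w‖ = 1 := by rw [LinearIsometryEquiv.norm_map, norm_eq_one_of_mem_fccSlots hw]
  have hsq : ‖G w - (2 * ⟪G w, m⟫_ℝ) • m‖ ^ 2 = 1 := by
    rw [@norm_sub_sq_real, norm_smul, hm, mul_one, inner_smul_right, h1, Real.norm_eq_abs, sq_abs]
    ring
  nlinarith [hsq, norm_nonneg (G w - (2 * ⟪G w, m⟫_ℝ) • m)]

/-- `IsTwinReading` agrees. -/
theorem isTwinReading_congr_of_agree (h : ∀ x, dist c x ≤ ρ → (x ∈ X ↔ x ∈ Y))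
    (G : EuclideanSpace ℝ (Fin 3) ≃ₗᵢ[ℝ] EuclideanSpace ℝ (Fin 3)) {m b : EuclideanSpace ℝ (Fin 3)}
    (hb : dist c b + 1 ≤ ρ) : IsTwinReading X G m b ↔ IsTwinReading Y G m b := by
  unfold IsTwinReading
  have hball : ∀ w ∈ fccSlots, dist c (b + G w) ≤ ρ := by
    intro w hw
    have : dist b (b + G w) = 1 := by
      rw [dist_eq_norm, sub_add_cancel_left, norm_neg, LinearIsometryEquiv.norm_map, norm_eq_one_of_mem_fccSlots hw]
    linarith [dist_triangle c b (b + G w)]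
  by_cases hm : ‖m‖ = 1
  · have hball' : ∀ w ∈ fccSlots, dist c (b + (G w - (2 * ⟪G w, m⟫_ℝ) • m)) ≤ ρ := by
      intro w hw
      have : dist b (b + (G w - (2 * ⟪G w, m⟫_ℝ) • m)) = 1 := by
        rw [dist_eq_norm, sub_add_cancel_left, norm_neg, norm_reflectStep_slot G hm hw]
      linarith [dist_triangle c b (b + (G w - (2 * ⟪G w, m⟫_ℝ) • m))]
    refine and_congr Iff.rfl (and_congr ?_ (and_congr ?_ ?_))
    · exact forall₂_congr fun w hw => imp_congr Iff.rfl (h _ (hball w hw))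
    · exact forall₂_congr fun w hw => imp_congr Iff.rfl (h _ (hball' w hw))
    · exact forall₂_congr fun w hw => imp_congr Iff.rfl (not_congr (h _ (hball w hw)))
  · -- not a unit normal: both sides are false
    constructor
    · rintro ⟨⟨hm1, -⟩, -⟩; exact absurd hm1 hm
    · rintro ⟨⟨hm1, -⟩, -⟩; exact absurd hm1 hm

/-- `IsNarrow` agrees (unit direction). -/
theorem isNarrow_congr_of_agree (h : ∀ x, dist c x ≤ ρ → (x ∈ X ↔ x ∈ Y))
    (G : EuclideanSpace ℝ (Fin 3) ≃ₗᵢ[ℝ] EuclideanSpace ℝ (Fin 3)) {d b : EuclideanSpace ℝ (Fin 3)} (hd : ‖d‖ = 1)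
    (hb : dist c b + 1 ≤ ρ) : IsNarrow X G d b ↔ IsNarrow Y G d b := by
  unfold IsNarrow
  have hbd : dist c (b + d) ≤ ρ := by
    have : dist b (b + d) = 1 := by rw [dist_eq_norm, sub_add_cancel_left, norm_neg, hd]
    linarith [dist_triangle c b (b + d)]
  have hball : ∀ w ∈ fccSlots, dist c (b + G w) ≤ ρ := by
    intro w hw
    have : dist b (b + G w) = 1 := by
      rw [dist_eq_norm, sub_add_cancel_left, norm_neg, LinearIsometryEquiv.norm_map, norm_eq_one_of_mem_fccSlots hw]
    linarith [dist_triangle c b (b + G w)]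
  refine and_congr (h _ hbd) (exists_congr fun m => and_congr Iff.rfl (and_congr Iff.rfl ?_))
  exact forall₂_congr fun w hw => imp_congr Iff.rfl (h _ (hball w hw))

/-- `IsMoving` agrees (unit direction). -/
theorem isMoving_congr_of_agree (h : ∀ x, dist c x ≤ ρ → (x ∈ X ↔ x ∈ Y)) (v : WordVersion)
    (G : EuclideanSpace ℝ (Fin 3) ≃ₗᵢ[ℝ] EuclideanSpace ℝ (Fin 3)) {d b : EuclideanSpace ℝ (Fin 3)} (hd : ‖d‖ = 1)
    (hb : dist c b + 1 ≤ ρ) : IsMoving X v G d b ↔ IsMoving Y v G d b := by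
  unfold IsMoving
  rw [isFull_congr_of_agree h G hb, isNarrow_congr_of_agree h G hd hb]
  refine or_congr Iff.rfl (or_congr (exists_congr fun m => ?_) Iff.rfl)
  rw [isTwinReading_congr_of_agree h G hb]

/-- The arriving direction of a cross move is a unit vector. -/
theorem norm_sub_eq_one_of_cross {d m b q : EuclideanSpace ℝ (Fin 3)} (hd : ‖d‖ = 1) (hm : ‖m‖ = 1)
    (hbq : b = q - (d - (2 * ⟪d, m⟫_ℝ) • m)) : ‖b - q‖ = 1 := by
  rw [hbq, show q - (d - (2 * ⟪d, m⟫_ℝ) • m) - q = -(d - (2 * ⟪d, m⟫_ℝ) • m) by abel, norm_neg]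
  have hsq : ‖d - (2 * ⟪d, m⟫_ℝ) • m‖ ^ 2 = 1 := by
    rw [@norm_sub_sq_real, norm_smul, hm, mul_one, inner_smul_right, hd, Real.norm_eq_abs, sq_abs]
    ring
  nlinarith [hsq, norm_nonneg (d - (2 * ⟪d, m⟫_ℝ) • m)]

/-- **`IsEndMove` agrees** when the configurations agree on `B̄(q, 1) ∪ B̄(b, 1)` (unit direction). -/
theorem isEndMove_congr_of_agree (h : ∀ x, dist c x ≤ ρ → (x ∈ X ↔ x ∈ Y)) (v : WordVersion)
    (G : EuclideanSpace ℝ (Fin 3) ≃ₗᵢ[ℝ] EuclideanSpace ℝ (Fin 3)) {d q b : EuclideanSpace ℝ (Fin 3)} (hd : ‖d‖ = 1)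
    (hq : dist c q + 1 ≤ ρ) (hb : dist c b + 1 ≤ ρ) : IsEndMove X v G d q b ↔ IsEndMove Y v G d q b := by
  unfold IsEndMove
  rw [isFull_congr_of_agree h G hq, isNarrow_congr_of_agree h G hd hq, isMoving_congr_of_agree h v G hd hb]
  refine or_congr (and_congr (or_congr Iff.rfl (or_congr Iff.rfl (exists_congr fun m => ?_))) Iff.rfl) ?_
  · rw [isTwinReading_congr_of_agree h G hq]
  · constructor
    · rintro ⟨m, htr, hdm, hbq, hnm⟩
      have hbq1 : ‖b - q‖ = 1 := norm_sub_eq_one_of_cross hd htr.1.1 hbq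
      exact ⟨m, (isTwinReading_congr_of_agree h G hq).1 htr, hdm, hbq,
        fun hmv => hnm ((isMoving_congr_of_agree h v _ hbq1 hb).2 hmv)⟩
    · rintro ⟨m, htr, hdm, hbq, hnm⟩
      have hbq1 : ‖b - q‖ = 1 := norm_sub_eq_one_of_cross hd htr.1.1 hbq
      exact ⟨m, (isTwinReading_congr_of_agree h G hq).2 htr, hdm, hbq,
        fun hmv => hnm ((isMoving_congr_of_agree h v _ hbq1 hb).1 hmv)⟩

end Agree

/-! ### Transport under a rigid motion `T x = S x + c` -/

section Transport

variable (X : Finset (EuclideanSpace ℝ (Fin 3))) (S : EuclideanSpace ℝ (Fin 3) ≃ₗᵢ[ℝ] EuclideanSpace ℝ (Fin 3))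
  (c : EuclideanSpace ℝ (Fin 3))

/-- A rigid motion preserves distances. -/
theorem dist_rigid (a b : EuclideanSpace ℝ (Fin 3)) : dist (S a + c) (S b + c) = dist a b := by
  rw [dist_add_right, LinearIsometryEquiv.dist_map]

/-- A rigid motion is injective. -/
theorem rigid_injective : Function.Injective fun x : EuclideanSpace ℝ (Fin 3) => S x + c :=
  fun _ _ h => S.injective (add_right_cancel h)

open scoped Classical in
/-- The unit sphere about `T y` in `T '' X` is the image of the unit sphere about `y` in `X`. -/
theorem filter_dist_image (y : EuclideanSpace ℝ (Fin 3)) :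
    ((X.image fun x => S x + c).filter fun q => dist (S y + c) q = 1) =
      (X.filter fun q => dist y q = 1).image fun x => S x + c := by
  ext q
  simp only [mem_filter, mem_image]
  constructor
  · rintro ⟨⟨x, hx, rfl⟩, hd⟩
    rw [dist_rigid] at hd
    exact ⟨x, ⟨hx, hd⟩, rfl⟩
  · rintro ⟨x, ⟨hx, hd⟩, rfl⟩
    exact ⟨⟨x, hx, rfl⟩, by rw [dist_rigid]; exact hd⟩

open scoped Classical in
/-- **Degrees transport.** -/
theorem degree_transport (y : EuclideanSpace ℝ (Fin 3)) :
    ((X.image fun x => S x + c).filter fun q => dist (S y + c) q = 1).card = (X.filter fun q => dist y q = 1).card := by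
  rw [filter_dist_image, card_image_of_injective _ (rigid_injective S c)]

open scoped Classical in
/-- **`HasTwoPayers` transports** (forward). -/
theorem hasTwoPayers_transport {b : EuclideanSpace ℝ (Fin 3)} (h : HasTwoPayers X b) :
    HasTwoPayers (X.image fun x => S x + c) (S b + c) := by
  rcases h with h | ⟨z₁, hz₁, z₂, hz₂, hne, hd₁, hd₂, hc₁, hc₂⟩
  · left; rwa [degree_transport]
  · right
    refine ⟨S z₁ + c, mem_image_of_mem _ hz₁, S z₂ + c, mem_image_of_mem _ hz₂,
      fun heq => hne (rigid_injective S c heq), by rw [dist_rigid]; exact hd₁, by rw [dist_rigid]; exact hd₂, ?_, ?_⟩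
    · rwa [degree_transport]
    · rwa [degree_transport]

open scoped Classical in
/-- **`pooledDef` transports.** -/
theorem pooledDef_transport (b : EuclideanSpace ℝ (Fin 3)) :
    pooledDef (X.image fun x => S x + c) (S b + c) = pooledDef X b := by
  unfold pooledDef
  have hset : (X.image fun x => S x + c).filter
        (fun z => dist (S b + c) z ≤ 1 ∧ ((X.image fun x => S x + c).filter fun q => dist z q = 1).card ≤ 11) =
      (X.filter fun z => dist b z ≤ 1 ∧ (X.filter fun q => dist z q = 1).card ≤ 11).image fun x => S x + c := by
    ext z
    simp only [mem_filter, mem_image]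
    constructor
    · rintro ⟨⟨x, hx, rfl⟩, hd, hcard⟩
      rw [dist_rigid] at hd
      rw [degree_transport] at hcard
      exact ⟨x, ⟨hx, hd, hcard⟩, rfl⟩
    · rintro ⟨x, ⟨hx, hd, hcard⟩, rfl⟩
      refine ⟨⟨x, hx, rfl⟩, by rw [dist_rigid]; exact hd, by rw [degree_transport]; exact hcard⟩
  rw [hset, sum_image fun x _ y _ h => rigid_injective S c h]
  refine sum_congr rfl fun x _ => ?_
  rw [degree_transport]

/-- **The frames of the transported plate system are the transported frames.** -/
theorem PlateSystem.fw_trans (L : EuclideanSpace ℝ (Fin 3) ≃ₗᵢ[ℝ] EuclideanSpace ℝ (Fin 3))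
    (R : Finset (EuclideanSpace ℝ (Fin 3))) :
    ∀ κ : List (EuclideanSpace ℝ (Fin 3)),
      (⟨L.trans S, R⟩ : PlateSystem).Fw κ = ((⟨L, R⟩ : PlateSystem).Fw κ).trans S := by
  intro κ
  induction κ with
  | nil => rfl
  | cons μ κ ih =>
    rw [PlateSystem.fw_cons, PlateSystem.fw_cons, ih]
    rfl

/-- **Admissible classes transport.** -/
theorem PlateSystem.adm_transport (L : EuclideanSpace ℝ (Fin 3) ≃ₗᵢ[ℝ] EuclideanSpace ℝ (Fin 3))
    (R : Finset (EuclideanSpace ℝ (Fin 3))) {G : EuclideanSpace ℝ (Fin 3) ≃ₗᵢ[ℝ] EuclideanSpace ℝ (Fin 3)}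
    {d : EuclideanSpace ℝ (Fin 3)} (h : (⟨L, R⟩ : PlateSystem).Adm G d) :
    (⟨L.trans S, R⟩ : PlateSystem).Adm (G.trans S) (S d) := by
  obtain ⟨r, hr, κ, hκ, hG, hd⟩ := h
  refine ⟨r, hr, κ, hκ, by rw [PlateSystem.fw_trans, hG], ?_⟩
  rw [PlateSystem.fw_trans, LinearIsometryEquiv.trans_apply, hd]

end Transport

/-! ### The on-site window in model position -/

open scoped Classical in
/-- **Under `OnSiteAt`, the transported configuration agrees with the pattern on the closed window.**  With the witness
`X ∩ B̄(z,3) = S·P + z`, the configuration `X.image (x ↦ S⁻¹ x − S⁻¹ z)` and `P` have the same points within `3` of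
the origin. -/
theorem onSite_window_agree {X P : Finset (EuclideanSpace ℝ (Fin 3))}
    {S : EuclideanSpace ℝ (Fin 3) ≃ₗᵢ[ℝ] EuclideanSpace ℝ (Fin 3)} {z : EuclideanSpace ℝ (Fin 3)}
    (hP : X.filter (fun x => dist z x ≤ 3) = P.image fun p => S p + z) :
    ∀ y, dist (0 : EuclideanSpace ℝ (Fin 3)) y ≤ 3 → (y ∈ X.image (fun x => S.symm x + -S.symm z) ↔ y ∈ P) := by
  intro y hy
  constructor
  · intro hyX
    obtain ⟨x, hx, rfl⟩ := mem_image.1 hyX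
    have hzx : dist z x ≤ 3 := by
      have : dist (S.symm z + -S.symm z) (S.symm x + -S.symm z) = dist z x := by
        rw [dist_add_right, LinearIsometryEquiv.dist_map]
      rw [add_neg_cancel] at this
      rwa [← this]
    have hmem : x ∈ X.filter (fun x => dist z x ≤ 3) := mem_filter.2 ⟨hx, hzx⟩
    rw [hP] at hmem
    obtain ⟨p, hp, rfl⟩ := mem_image.1 hmem
    rw [map_add, LinearIsometryEquiv.symm_apply_apply, add_neg_cancel_right]
    exact hp
  · intro hyP
    have hmem : S y + z ∈ X.filter (fun x => dist z x ≤ 3) := by rw [hP]; exact mem_image_of_mem _ hyP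
    refine mem_image.2 ⟨S y + z, (mem_filter.1 hmem).1, ?_⟩
    rw [map_add, LinearIsometryEquiv.symm_apply_apply, add_neg_cancel_right]

end Summit.Ventures.Crystal3D.Theorems

end
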